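import Mathlib.LinearAlgebra.Dimension.Constructions
import Summits.HodgeConjecture.HodgeConjecture.Theorems.LinearSystemTorelliLocalTubeSpanDistinguishedBasis
import Summits.HodgeConjecture.HodgeConjecture.Theorems.LinearSystemTorelliLocalTubeSpanReduction

/-!
# Route LinearSystemTorelli — crux `LocalTubeSpan`: linearly independent cycles, unconditionally

Helper file (`--supports stmt-HodgeConjecture-2490`, line `Sketch`, cycle 4 wave 3, stub
`stub_independentCycles`).  The crux ("local Schnell theorem", C. Schnell, *Primitive cohomology
and the tube mapping*, Math. Z. 268 (2010) §3, §7) is reduced by the line to CYCLIC DETECTION —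
injectivity of Schnell's third map `evalCoinv A : H¹(G, V) → ∏_{g ∈ G} V/(g - 1)V` — for the local
fundamental group `G = G_{s₀}` of the discriminant complement acting on the vanishing cohomology
`V` through Picard–Lefschetz transvections `x ↦ x - B(x, e_t) e_t` of the nondegenerate alternating
intersection form `B`.  This file is the case of LINEARLY INDEPENDENT generating cycles, WITHOUT
the named facts `Schnell2010_lemma11` / `Janssen1983_thm2_9` and without any connectedness
hypothesis on the Dynkin graph:

* `localTubeSpan_injective_evalCoinv_of_independentCycles` — if `G` is generated by a finite set
  `s` of elements acting as transvections along LINEARLY INDEPENDENT cycles `e_t`, `t ∈ s`, of a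
  nondegenerate alternating form `B`, then Schnell's third map is injective.

Proof: split the Dynkin graph of `s` (vertices `t ∈ s`, edges `B(e_t, e_{t'}) ≠ 0`) into its
non-isolated vertices `s'` and its isolated vertices `s ∖ s'`.  On the subgroup `⟨s'⟩` the third
map is injective by the distinguished-basis theorem
`localTubeSpan_injective_evalCoinv_of_distinguishedBasis` (independent cycles, every vertex of `s'`
has a neighbour, which again lies in `s'` since `B` is alternating); the isolated cycles are
linearly independent modulo `span {e_t : t ∈ s'}` because all of `e(s)` is independent
(`linearIndepOn_union_iff_quotient`), so the sub-configuration reduction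
`localTubeSpan_injective_evalCoinv_of_subconfiguration` (coboundary adjustment on `⟨s'⟩`, then
`B`-duality) gives injectivity for `G`.

References: [Schnell2010] C. Schnell, Primitive cohomology and the tube mapping, Math. Z. 268
(2010) §7 Prop. 12.
-/

-- `Summit.HodgeConjecture.HodgeConjecture.Theorems` is the mandated namespace (single-conjunct summit:
-- Sub = Summit), which `linter.dupNamespace` flags on every declaration; the lakefile turns the
-- linter off tree-wide (weak option), restated here so stand-alone elaboration is warning-free too.
set_option linter.dupNamespace false

noncomputable section

open CategoryTheory groupCohomology
open Literature.AlgebraicGeometry.HodgeTheory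

namespace Summit.HodgeConjecture.HodgeConjecture.Theorems

section IndependentCycles

/-- **The non-isolated part of the Dynkin graph, unconditionally.**  Let `G` act on the
finite-dimensional `ℚ`-space `V = A` through transvections `x ↦ x - B(x, e_t) e_t` (`t ∈ s`) of an
alternating form `B` along LINEARLY INDEPENDENT cycles `e_t`, `t ∈ s` (`s` finite), and let
`s' ⊆ s` be a sub-configuration every vertex of which has a `B`-neighbour inside `s'`.  Then
Schnell's third map of the restricted representation of `⟨s'⟩` is injective: enumerate `s'` and
apply `localTubeSpan_injective_evalCoinv_of_distinguishedBasis`. [cite: Schnell2010, §7 Prop. 12] -/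
theorem localTubeSpan_injective_evalCoinv_res_closure_of_independentCycles {G : Type} [Group G]
    (A : Rep.{0} ℚ G) [FiniteDimensional ℚ A.V] (B : LinearMap.BilinForm ℚ A.V) (hBalt : B.IsAlt)
    (s : Set G) (e : G → A.V) (hPL : ∀ t ∈ s, ∀ x : A.V, A.ρ t x = x - B x (e t) • e t)
    (hli : LinearIndependent ℚ (fun t : s => e t)) (s' : Set G) (hs'fin : s'.Finite)
    (hs's : s' ⊆ s) (hconn : ∀ t ∈ s', ∃ t' ∈ s', B (e t) (e t') ≠ 0) :
    Function.Injective (evalCoinv (Rep.res (Subgroup.closure s').subtype A)) := by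
  haveI : Fintype ↥s' := hs'fin.fintype
  -- enumerate the sub-configuration: generators `t i ∈ ⟨s'⟩` and their cycles `δ i`
  set φ : Fin (Fintype.card ↥s') ≃ ↥s' := (Fintype.equivFin ↥s').symm with hφ
  set t : Fin (Fintype.card ↥s') → ↥(Subgroup.closure s') :=
    fun i => ⟨(φ i : G), Subgroup.subset_closure (φ i).2⟩ with ht
  refine localTubeSpan_injective_evalCoinv_of_distinguishedBasis
    (Rep.res (Subgroup.closure s').subtype A) B hBalt t ?_ (fun i => e (φ i)) ?_ ?_ ?_
  · -- the `t i` generate `⟨s'⟩`: their range is the preimage of `s'` in `⟨s'⟩`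
    have hrange : Set.range t = ((↑) : Subgroup.closure s' → G) ⁻¹' s' := by
      ext x
      refine ⟨?_, fun hx => ⟨φ.symm ⟨(x : G), hx⟩, Subtype.ext ?_⟩⟩
      · rintro ⟨i, rfl⟩
        exact (φ i).2
      · change ((φ (φ.symm ⟨(x : G), hx⟩) : ↥s') : G) = x
        rw [Equiv.apply_symm_apply]
    rw [hrange]
    exact Subgroup.closure_closure_coe_preimage
  · -- the cycles `e (φ i)` are among the independent family `e|_s`
    exact (hli.comp (Set.inclusion hs's) (Set.inclusion_injective hs's)).comp φ φ.injective
  · -- the generators act as the prescribed transvections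
    intro i x
    rw [Rep.coe_res_obj_ρ']
    exact hPL _ (hs's (φ i).2) x
  · -- every vertex of `s'` has a neighbour in `s'`
    intro i
    obtain ⟨t', ht', hne⟩ := hconn _ (φ i).2
    refine ⟨φ.symm ⟨t', ht'⟩, ?_⟩
    rwa [Equiv.apply_symm_apply]

/-- **Linearly independent cycles, unconditionally** (stub `stub_independentCycles` of line
`Sketch`).  Let `G` be generated by a finite set `s` and act on the finite-dimensional `ℚ`-space
`V = A` through Picard–Lefschetz transvections `x ↦ x - B(x, e_t) e_t` (`t ∈ s`) of a
nondegenerate alternating form `B`, the cycles `e_t`, `t ∈ s`, being LINEARLY INDEPENDENT.  Then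
Schnell's third map `H¹(G, V) → ∏_{g ∈ G} V/(g - 1)V` is injective.  Proof: the sub-configuration
reduction `localTubeSpan_injective_evalCoinv_of_subconfiguration` with `s'` the non-isolated
vertices of the Dynkin graph — injectivity on `⟨s'⟩` by the distinguished-basis theorem, the
isolated cycles being independent modulo `span e(s')` by `linearIndepOn_union_iff_quotient`.  No
named fact (neither `Schnell2010_lemma11` nor `Janssen1983_thm2_9`) is used.
[cite: Schnell2010, §7 Prop. 12] -/
theorem localTubeSpan_injective_evalCoinv_of_independentCycles {G : Type} [Group G]
    (A : Rep.{0} ℚ G) [FiniteDimensional ℚ A.V] (B : LinearMap.BilinForm ℚ A.V)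
    (hB : B.Nondegenerate) (hBalt : B.IsAlt) (s : Set G) (hsfin : s.Finite)
    (hs : Subgroup.closure s = ⊤) (e : G → A.V)
    (hPL : ∀ t ∈ s, ∀ x : A.V, A.ρ t x = x - B x (e t) • e t)
    (hli : LinearIndependent ℚ (fun t : s => e t)) :
    Function.Injective (evalCoinv A) := by
  -- the non-isolated vertices of the Dynkin graph of `s`
  set s' : Set G := {t ∈ s | ∃ t' ∈ s, B (e t) (e t') ≠ 0} with hs'def
  have hs's : s' ⊆ s := Set.sep_subset s _
  refine localTubeSpan_injective_evalCoinv_of_subconfiguration A B hB s hs e hPL s' hs's ?_ ?_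
  · -- injectivity on `⟨s'⟩`: a neighbour `t'` of `t ∈ s'` lies in `s'` (witness `t`, `B` alternating)
    refine localTubeSpan_injective_evalCoinv_res_closure_of_independentCycles A B hBalt s e hPL hli
      s' (hsfin.subset hs's) hs's fun t ht => ?_
    obtain ⟨t', ht's, hne⟩ := ht.2
    refine ⟨t', ⟨ht's, t, ht.1, ?_⟩, hne⟩
    rwa [← hBalt.neg_eq, neg_ne_zero]
  · -- the isolated cycles are independent modulo `span e(s')`, all of `e(s)` being independent
    have hli' : LinearIndepOn ℚ e (s' ∪ s \ s') := by
      rw [Set.union_sdiff_cancel hs's]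
      exact hli
    exact ((linearIndepOn_union_iff_quotient Set.disjoint_sdiff_right).1 hli').2

end IndependentCycles

end Summit.HodgeConjecture.HodgeConjecture.Theorems

end
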